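import Summits.CriticalPhenomena.PercolationContinuityZ3.Theorems.PercNearOneGluingNoHeavyQuantGluedWindowLight
import HarnessLib

/-!
# QUANT lane R8, T-DEC: LEMMA W's pair condition PROVED in its fourth cell — all three copies of the low atom low, the two lower copies `l`, `l + r`
# INCOMPATIBLE with `h` at the raised target (no `GluedLemmaW` hypothesis; arm-1 gen 59, architect)

builds on p205010 (kernel theorem, internal audit signed; external expert review pending)

Support file (`--supports stmt-CriticalPhenomena-4575`), QUANT lane seat prim-quant-arm-1 (gen 59, architect); memo
`run/shared/lean/prim/quant/prim-quant-arm-1-g59/ARCH-G59.md` §3.  Theorems only; standard axioms, no sorries, no definitions; one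
declaration at `maxHeartbeats 6000000` (long real bookkeeping, no heavy automation).

WHAT.  Companion of `…QuantGluedWindowLight` (`gluedPullback_windowPair_lowTriple_light`: the pair still light at `T`).  Here the low atom
`l` is NO LONGER LIGHT for `h` at `T = T₀ + Δ` (`y(h − l) < T − 2l`) while its middle copy `l + r` still is (`T < l + r + h`,
`T − 2(l+r) ≤ y(h − l − r)`); all three copies are low (`2(l+r+k) < T`, `l+r+k ≤ j`).  Then, for every price system in which an atom
`c ∈ [h, min(j,B)]` is cheap, the pair condition `(1−γ)Ψ(l) + γΨ(h) ≤ 0` holds: `gluedPullback_windowPair_lowTriple_heavyCompat` (companion file `…QuantGluedWindowHeavyLow`) and `gluedPullback_windowPair_lowTriple_incompat` (this file).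
The proof is the two-column criterion of the memo (§3) made explicit:
* column A = the mid copies of `h` (`h`, and `h + r` if `≤ j`, price `p_A = min`), pool = its giant copies at the least giant price `P`
  (`pool_bound`: every copy of `l` rides the pool at `usage(·, h)`; the atom `l` itself at the giant rate `u = y/(1−y)`);
* if `l` is still COMPATIBLE (`T < l + h`, heavy: `usage(l,h) = ρ/(1−ρ) ≥ u`): `GluedWindow.twoCol_breakpoint` with the three breakpoint
  inequalities — at `θ = 1` the capped chord inequality (`p2l` with `u ≤` the light formula of the heavy copy), at `θ = u/κ₀` cell B0,
  which is the chord inequality plus `GluedWindow.heavy_row_ineq` (the regime fact `ρ_T(l)(1 + t₀) ≤ 2ρ₀` comes from `2(r+k) < T − 2l` and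
  `Δ ≤ m ≤ (1−t₀)(r+k)`), through the identity `κ₀ − F(ρ) = (κ₀ − u)·y/(1+y−ρ)`;
* if `l` is INCOMPATIBLE (`T ≥ l + h`): it rides the pool, paid by `GluedWindow.inc_row_ineq` (regime fact `t₀ ≤ ρ₀` from
  `(1−ρ₀)(h−l) ≤ Δ < (1−t₀)(h−l)`), the two light copies by the capped chord inequality.
REMAINING CELLS of LEMMA W (memo §3–§4): the middle copy heavy (`B1` by `heavy_row_ineq` — routine — plus, when `l` is compatible, the open
`TwoHeavyRowsIneq`), and the two-row regime `l + r + k` a non-low mid.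

HONEST STATUS.  `GluedLemmaW` (flow form), `GluedDominatedMass`, the band, `SiblingStep`, `FarTreeRow` OPEN; RATE class (log\*) / honest
sentence of `run/shared/lean/prim/quant/README.md` unchanged.  [this work].  Nothing here is cited as a published result.  The gluing rows served
[cite: KozmaNitzan2024, Conjecture 3 (p. 15)]; product measure [cite: Grimmett1999, §1.3 p. 10].
-/

noncomputable section

open scoped BigOperators

namespace Summit.CriticalPhenomena.PercolationContinuityZ3.Theorems
namespace Quant

open Finset

namespace LawDec

/-- the point mass `δ_K` -/
local notation3 "δ[" K "]" => (fun k : ℕ => if k = (K : ℕ) then (1 : ℝ) else 0)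

/-- the two-point law `{lo, lo+K; g}` -/
local notation3 "TPL[" lo ", " K ", " g "]" => lconv lo K δ[lo] (gate δ[K] g)

set_option maxHeartbeats 4000000 in
/-- **THE LIGHT WINDOW PAIR CONDITION BELOW A CHEAP ATOM — CELL: the three copies of the low atom are low and the two lower ones, `l` and
`l + r`, are INCOMPATIBLE with `h` at the raised target (`T ≥ l + r + h`)** (no `GluedLemmaW` hypothesis).  Proof: both ride the pool at the giant rate,
paid by `inc_row_ineq` with `t₀ + t₁ ≤ ρ₀` (regime: `(1−ρ₀)(h−l) ≤ Δ − r ≤ t₂k`); the top copy by the capped chord inequality (memo ARCH-G59 §3). [this work] -/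
theorem gluedPullback_windowPair_lowTriple_incompat₂ (x a q g S : ℝ) (B r k j l h c ls : ℕ) (α p : ℕ → ℝ)
    (hx0 : 0 < x) (hx1 : x < 1) (ha0 : 0 < a) (ha1 : a ≤ 1) (hq0 : 0 < q) (hq1 : q < 1) (hg0 : 0 ≤ g) (hg1 : g ≤ 1) (hr : 1 ≤ r) (hk : 1 ≤ k)
    (hxqg : x ≤ q * g) (hband1 : 2 * (r : ℝ) < q * ((r : ℝ) + k * g)) (hjM : j < B + (r + k))
    (hlh : l < h) (hhB : h ≤ B) (hhj : h ≤ j) (hwin : j < h + r + k) (hcomp : a * S < (l : ℝ) + h)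
    (hlight : pairGate (a * x) (a * S) l h < a * x)
    (hhc : h ≤ c) (hcB : c ≤ B) (hcj : c ≤ j)
    (hp : ∀ h, 0 ≤ p h)
    (hαp : ∀ l' h', l' ≤ j → 2 * (l' : ℝ) < a * (S + q * ((r : ℝ) + k * g)) → h' ≤ B + (r + k) → (j + 1 ≤ h' ∨ a * (S + q * ((r : ℝ) + k * g)) < (l' : ℝ) + h') →
      α l' ≤ usage (a * x) (a * (S + q * ((r : ℝ) + k * g))) j l' h' * p h')
    (hcheap : -(gluedPullback (a * (S + q * ((r : ℝ) + k * g))) q g j r k α p c) * (a * x) < (1 - a * x) * gluedPullback (a * (S + q * ((r : ℝ) + k * g))) q g j r k α p ls)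
    (hB3 : 2 * ((l : ℝ) + r + k) < a * (S + q * ((r : ℝ) + k * g))) (hB3' : l + r + k ≤ j)
    (hheavy0 : (a * x) * ((h : ℝ) - l) < a * (S + q * ((r : ℝ) + k * g)) - 2 * (l : ℝ))
    (hinc1 : (l : ℝ) + r + h ≤ a * (S + q * ((r : ℝ) + k * g))) :
    (1 - pairGate (a * x) (a * S) l h) * gluedPullback (a * (S + q * ((r : ℝ) + k * g))) q g j r k α p l
      + pairGate (a * x) (a * S) l h * gluedPullback (a * (S + q * ((r : ℝ) + k * g))) q g j r k α p h ≤ 0 := by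
  set y : ℝ := a * x with hy; set T : ℝ := a * (S + q * ((r : ℝ) + k * g)) with hT; set T₀ : ℝ := a * S with hT₀; set t0 : ℝ := 1 - q with ht0
  set t1 : ℝ := q * (1 - g) with ht1; set t2 : ℝ := q * g with ht2; clear_value y T T₀ t0 t1 t2; have hy0 : 0 < y := by rw [hy]; exact mul_pos ha0 hx0
  have hyx : y ≤ x := by rw [hy]; nlinarith
  have hy1 : y < 1 := by linarith
  have h1y : 0 < 1 - y := by linarith
  have ht0p : 0 ≤ t0 := by rw [ht0]; linarith
  have ht1p : 0 ≤ t1 := by rw [ht1]; exact mul_nonneg hq0.le (by linarith)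
  have ht2p : 0 ≤ t2 := by rw [ht2]; exact mul_nonneg hq0.le hg0
  have hts : t0 + t1 + t2 = 1 := by rw [ht0, ht1, ht2]; ring
  have hmK : q * ((r : ℝ) + k * g) ≤ (r : ℝ) + k := by
    have : (0:ℝ) ≤ (k : ℝ) * (1 - g) := mul_nonneg (by positivity) (by linarith)
    nlinarith [mul_le_mul_of_nonneg_left hq1.le (show (0:ℝ) ≤ (r : ℝ) + k * g by positivity)]
  have hΔ0 : T₀ ≤ T := by rw [hT, hT₀]; nlinarith [mul_nonneg ha0.le (show (0:ℝ) ≤ q * ((r:ℝ) + k * g) by positivity)]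
  have hΔm : T - T₀ ≤ t1 * r + t2 * ((r : ℝ) + k) := by
    rw [hT, hT₀, ht1, ht2]
    have h1 : a * (q * ((r : ℝ) + k * g)) ≤ q * ((r : ℝ) + k * g) := by
      have := mul_le_mul_of_nonneg_right ha1 (show (0:ℝ) ≤ q * ((r:ℝ) + k * g) by positivity)
      linarith
    have e : q * (1 - g) * (r : ℝ) + q * g * ((r : ℝ) + k) = q * ((r : ℝ) + k * g) := by ring
    have e2 : a * (S + q * ((r : ℝ) + k * g)) - a * S = a * (q * ((r : ℝ) + k * g)) := by ring
    linarith
  have hlh' : (l : ℝ) < h := by exact_mod_cast hlh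
  have hK0 : (0:ℝ) ≤ (r : ℝ) + k := by positivity
  have hmK' : t1 * r + t2 * ((r : ℝ) + k) ≤ (r : ℝ) + k := by
    have a1 : t1 * (r : ℝ) ≤ t1 * ((r : ℝ) + k) := mul_le_mul_of_nonneg_left (by linarith [show (0:ℝ) ≤ k from Nat.cast_nonneg k]) ht1p; have a2 : 0 ≤ t0 * ((r : ℝ) + k) := mul_nonneg ht0p hK0
    have e3 : t1 * ((r : ℝ) + k) + t2 * ((r : ℝ) + k) + t0 * ((r : ℝ) + k) = (r : ℝ) + k := by
      calc t1 * ((r : ℝ) + k) + t2 * ((r : ℝ) + k) + t0 * ((r : ℝ) + k) = (t0 + t1 + t2) * ((r : ℝ) + k) := by ring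
        _ = (r : ℝ) + k := by rw [hts, one_mul]
    linarith
  have hΔK : T - T₀ ≤ (r : ℝ) + k := le_trans hΔm hmK'; have hdK : ((r : ℝ) + k) < (h : ℝ) - l := by linarith
  have h2h : T < 2 * (h : ℝ) := by linarith
  have hL0 : l ≤ j ∧ 2 * (l : ℝ) < T := ⟨by omega, by linarith⟩
  have hL1 : l + r ≤ j ∧ 2 * ((l + r : ℕ) : ℝ) < T := ⟨by omega, by push_cast; linarith [show (0:ℝ) ≤ k from Nat.cast_nonneg k]⟩
  have hL2 : l + r + k ≤ j ∧ 2 * ((l + r + k : ℕ) : ℝ) < T := ⟨hB3', by push_cast; linarith⟩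
  have nonlow : ∀ v : ℕ, h ≤ v → ¬ (v ≤ j ∧ 2 * (v : ℝ) < T) := by
    intro v hv ⟨_, hv2⟩
    have : (h : ℝ) ≤ v := by exact_mod_cast hv
    linarith
  have cL : ∀ v : ℕ, (v ≤ j ∧ 2 * (v : ℝ) < T) → coefAt T j α p v = α v := fun v hv => by simp only [coefAt, if_pos hv]
  have cH : ∀ v : ℕ, h ≤ v → coefAt T j α p v = -p v := fun v hv => by simp only [coefAt, if_neg (nonlow v hv)]
  have eΨl : gluedPullback T q g j r k α p l = t0 * α l + t1 * α (l + r) + t2 * α (l + r + k) := by simp only [gluedPullback, cL l hL0, cL (l + r) hL1, cL (l + r + k) hL2, ht0, ht1, ht2]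
  have eΨh : gluedPullback T q g j r k α p h = -(t0 * p h + t1 * p (h + r) + t2 * p (h + r + k)) := by
    simp only [gluedPullback, cH h le_rfl, cH (h + r) (by omega), cH (h + r + k) (by omega), ht0, ht1, ht2]; ring
  have eΨc : gluedPullback T q g j r k α p c = -(t0 * p c + t1 * p (c + r) + t2 * p (c + r + k)) := by
    simp only [gluedPullback, cH c hhc, cH (c + r) (by omega), cH (c + r + k) (by omega), ht0, ht1, ht2]; ring
  obtain ⟨q1, hq1d⟩ : ∃ q1 : ℝ, q1 = if h + r ≤ j then p (h + r + k) else p (h + r) := ⟨_, rfl⟩; obtain ⟨q2, hq2d⟩ : ∃ q2 : ℝ, q2 = if c + r ≤ j then p (c + r + k) else p (c + r) := ⟨_, rfl⟩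
  obtain ⟨P, hP⟩ : ∃ P : ℝ, P = min (min (p (h + r + k)) (p (c + r + k))) (min q1 q2) := ⟨_, rfl⟩
  have hPH2 : P ≤ p (h + r + k) := by rw [hP]; exact le_trans (min_le_left _ _) (min_le_left _ _)
  have hPC2 : P ≤ p (c + r + k) := by rw [hP]; exact le_trans (min_le_left _ _) (min_le_right _ _)
  have hPq1 : P ≤ q1 := by rw [hP]; exact le_trans (min_le_right _ _) (min_le_left _ _)
  have hPq2 : P ≤ q2 := by rw [hP]; exact le_trans (min_le_right _ _) (min_le_right _ _)
  have hP0 : 0 ≤ P := by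
    rw [hP]; refine le_min (le_min (hp _) (hp _)) (le_min ?_ ?_)
    · rw [hq1d]; split_ifs <;> exact hp _
    · rw [hq2d]; split_ifs <;> exact hp _
  have giantBound : ∀ G : ℕ, j + 1 ≤ G → G ≤ B + (r + k) → gluedPullback T q g j r k α p ls ≤ y / (1 - y) * p G :=
    fun G hGj hGM => gluedPullback_le_giant y T q g j r k (B + (r + k)) α p hy0 hy1 hq0.le hq1.le hg0 hg1 hp hαp ls G hGj hGM
  have hΨls : gluedPullback T q g j r k α p ls ≤ y / (1 - y) * P := by
    have u0 : 0 ≤ y / (1 - y) := div_nonneg hy0.le h1y.le; have b1 := giantBound (h + r + k) (by omega) (by omega); have b2 := giantBound (c + r + k) (by omega) (by omega)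
    have b3 : gluedPullback T q g j r k α p ls ≤ y / (1 - y) * q1 := by
      rw [hq1d]; split_ifs with hh
      · exact b1
      · exact giantBound (h + r) (by omega) (by omega)
    have b4 : gluedPullback T q g j r k α p ls ≤ y / (1 - y) * q2 := by
      rw [hq2d]; split_ifs with hh
      · exact b2
      · exact giantBound (c + r) (by omega) (by omega)
    rw [hP]
    rcases min_choice (min (p (h + r + k)) (p (c + r + k))) (min q1 q2) with e | e <;> rw [e]
    · rcases min_choice (p (h + r + k)) (p (c + r + k)) with e' | e' <;> rw [e'] <;> assumption
    · rcases min_choice q1 q2 with e' | e' <;> rw [e'] <;> assumption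
  have havg : t0 * p c + t1 * p (c + r) + t2 * p (c + r + k) < P := by
    have := cheap_neg_pullback_lt y _ _ P hy0 hy1 hcheap hΨls; rw [eΨc, neg_neg] at this; exact this
  have hC1 : j + 1 ≤ c + r ∧ P ≤ p (c + r) ∨ c + r ≤ j := by
    by_cases hcr : c + r ≤ j
    · exact Or.inr hcr
    · refine Or.inl ⟨by omega, ?_⟩
      have : q2 = p (c + r) := by rw [hq2d, if_neg hcr]
      rw [← this]; exact hPq2
  have poolB : ∀ w : ℕ, w ≤ j → 2 * (w : ℝ) < T → T < (w : ℝ) + c → α w ≤ usage y T j w c * P := by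
    intro w hwj hwl hwc
    refine pool_bound y T q g P j (B + (r + k)) c r k w α p hy0 hy1 hq0.le hq1.le hg0 hg1 hp hαp hwj hwl hwc (by omega) hr ?_ hPC2 hC1
    rw [ht0, ht1, ht2] at havg; exact havg
  have hd0 : (0:ℝ) < (h : ℝ) - l := by linarith
  obtain ⟨ρ₀, hρ₀⟩ : ∃ ρ₀ : ℝ, ρ₀ = (T₀ - 2 * (l : ℝ)) / ((h : ℝ) - l) := ⟨_, rfl⟩
  have hρ₀y : ρ₀ < y := by
    have : (T₀ - 2 * (l : ℝ)) / ((h : ℝ) - l) ≤ pairGate y T₀ l h := le_max_left _ _; rw [hρ₀]; linarith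
  have hγ : pairGate y T₀ l h = y ^ 2 + (1 - y) * ρ₀ := by rw [hρ₀]; exact pairGate_eq_light y T₀ l h hy0.le (by rw [← hρ₀]; exact hρ₀y.le)
  have hL1r : ((l + r : ℕ) : ℝ) = (l : ℝ) + r := by push_cast; ring
  have hL2r : ((l + r + k : ℕ) : ℝ) = (l : ℝ) + r + k := by push_cast; ring
  obtain ⟨ρa, hρa⟩ : ∃ ρa : ℝ, ρa = (T - 2 * (l : ℝ)) / ((h : ℝ) - l) := ⟨_, rfl⟩; obtain ⟨ρb, hρb⟩ : ∃ ρb : ℝ, ρb = (T - 2 * ((l + r : ℕ) : ℝ)) / ((h : ℝ) - ((l + r : ℕ) : ℝ)) := ⟨_, rfl⟩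
  obtain ⟨ρc, hρc⟩ : ∃ ρc : ℝ, ρc = (T - 2 * ((l + r + k : ℕ) : ℝ)) / ((h : ℝ) - ((l + r + k : ℕ) : ℝ)) := ⟨_, rfl⟩; have hρay : y < ρa := by rw [hρa, lt_div_iff₀ hd0]; linarith
  have hρa1y : ρa < 1 + y := by
    have h1 : T₀ - 2 * (l : ℝ) < y * ((h : ℝ) - l) := by have := hρ₀y; rw [hρ₀, div_lt_iff₀ hd0] at this; linarith
    rw [hρa, div_lt_iff₀ hd0]; nlinarith
  have hr0 : (0:ℝ) ≤ r := Nat.cast_nonneg r; have hk0' : (0:ℝ) ≤ k := Nat.cast_nonneg k; have hdb : (0:ℝ) < (h : ℝ) - ((l : ℝ) + r) := by linarith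
  have hzbTop : 0 < 1 + y - ρb := by
    have e1 : ρb * ((h : ℝ) - ((l : ℝ) + r)) = T - 2 * ((l : ℝ) + r) := by rw [hρb, hL1r]; field_simp
    have h1 : T₀ - 2 * (l : ℝ) < y * ((h : ℝ) - l) := by have := hρ₀y; rw [hρ₀, div_lt_iff₀ hd0] at this; linarith
    have hyr : y * (r : ℝ) ≤ r := mul_le_of_le_one_left hr0 hy1.le; have hb1 : T - 2 * ((l : ℝ) + r) < (1 + y) * ((h : ℝ) - ((l : ℝ) + r)) := by linarith
    rw [← e1] at hb1
    have := lt_of_mul_lt_mul_right hb1 hdb.le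
    linarith
  have hρby : 1 ≤ ρb := by rw [hρb, hL1r, le_div_iff₀ hdb]; linarith
  have hρcb : ρc ≤ ρb := by
    have s1 : (l : ℝ) + r ≤ (l : ℝ) + r + k := by linarith
    have s2 : (l : ℝ) + r + k < (h : ℝ) := by linarith
    have := ratio_anti_low T ((l : ℝ) + r) ((l : ℝ) + r + k) (h : ℝ) s1 s2 h2h.le; rw [hρc, hρb, hL2r, hL1r]; exact this
  have hρcy : ρc ≤ y := by
    have eT₀' : T₀ - 2 * (l : ℝ) = ρ₀ * ((h : ℝ) - l) := by rw [hρ₀]; field_simp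
    have hdc : (0:ℝ) < (h : ℝ) - ((l : ℝ) + r + k) := by linarith
    rw [hρc, hL2r, div_le_iff₀ hdc]
    nlinarith [mul_nonneg (sub_nonneg.2 hρ₀y.le) hd0.le, hΔK, hK0, mul_nonneg (show (0:ℝ) ≤ 1 - ρ₀ by linarith) hK0]
  have eκc : usage y T j (l + r + k) h = (y ^ 2 + (1 - y) * ρc) / (1 - (y ^ 2 + (1 - y) * ρc)) := by rw [hρc]; exact usage_light_eq y T j (l + r + k) h hy0.le hhj (by rw [← hρc]; exact hρcy)
  have hcompT2 : T < ((l + r + k : ℕ) : ℝ) + h := by rw [hL2r]; linarith [hK0]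
  have hlt1 : l + r < h := by
    have hh : ((l + r : ℕ) : ℝ) < h := by rw [hL1r]; linarith
    exact_mod_cast hh
  have hlt2 : l + r + k < h := by
    have hh : ((l + r + k : ℕ) : ℝ) < h := by rw [hL2r]; linarith
    exact_mod_cast hh
  have hκc0 : 0 ≤ usage y T j (l + r + k) h := (usage_pos_of_compat y T j (l + r + k) h hy0 hy1 hL2.2 hlt2 (Or.inr hcompT2)).le
  obtain ⟨pA, hpA⟩ : ∃ pA : ℝ, pA = if h + r ≤ j then min (p h) (p (h + r)) else p h := ⟨_, rfl⟩; have hpAh : pA ≤ p h := by rw [hpA]; split_ifs; exacts [min_le_left _ _, le_rfl]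
  have rowBound : ∀ (L : ℕ), l ≤ L → L ≤ j ∧ 2 * (L : ℝ) < T → T < (L : ℝ) + h → α L ≤ usage y T j L h * min pA P := by
    intro L hlL hL hLc
    have hLh : L < h := by
      have hh : (L : ℝ) < h := by linarith [hL.2]
      exact_mod_cast hh
    have u0 : 0 ≤ usage y T j L h := (usage_pos_of_compat y T j L h hy0 hy1 hL.2 hLh (Or.inr hLc)).le; rw [mul_min_of_nonneg _ _ u0]
    refine le_min ?_ ?_
    · -- column A: h itself, and h + r if it is a mid
      have bh : α L ≤ usage y T j L h * p h := hαp L h hL.1 hL.2 (by omega) (Or.inr hLc); rw [hpA]; split_ifs with hmid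
      · rw [mul_min_of_nonneg _ _ u0]
        refine le_min bh ?_
        have hLc1 : T < (L : ℝ) + (h + r : ℕ) := by push_cast; linarith [show (0:ℝ) ≤ r from Nat.cast_nonneg r]
        have b1 : α L ≤ usage y T j L (h + r) * p (h + r) := hαp L (h + r) hL.1 hL.2 (by omega) (Or.inr hLc1)
        exact le_trans b1 (mul_le_mul_of_nonneg_right (usage_anti_mid y T j L h (h + r) hy0 hy1 (by omega) hmid hL.2 hLc) (hp _))
      · exact bh
    · -- pool: the cheap pseudo-mid at c ≥ h
      have hhc' : (h : ℝ) ≤ c := by exact_mod_cast hhc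
      have hLcc : T < (L : ℝ) + c := by linarith
      have bc := poolB L hL.1 hL.2 hLcc
      rcases Nat.lt_or_ge h c with hlt | hge
      · exact le_trans bc (mul_le_mul_of_nonneg_right (usage_anti_mid y T j L h c hy0 hy1 hlt hcj hL.2 hLc) hP0)
      · have : c = h := le_antisymm hge hhc
        rw [this] at bc; exact bc
  have bC := rowBound (l + r + k) (by omega) hL2 hcompT2; have hQ0 : min pA P ≤ p h := le_trans (min_le_left _ _) hpAh
  have hQ1 : min pA P ≤ p (h + r) := by
    by_cases hmid : h + r ≤ j
    · have : pA ≤ p (h + r) := by rw [hpA, if_pos hmid]; exact min_le_right _ _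
      exact le_trans (min_le_left _ _) this
    · have : q1 = p (h + r) := by rw [hq1d, if_neg hmid]
      exact le_trans (min_le_right _ _) (by rw [← this]; exact hPq1)
  have hQ2 : min pA P ≤ p (h + r + k) := le_trans (min_le_right _ _) hPH2
  have hP2 : (1 - (y ^ 2 + (1 - y) * ρ₀)) * (t0 * ((y ^ 2 + (1 - y) * ρa) / (1 - (y ^ 2 + (1 - y) * ρa)))
      + t1 * ((y ^ 2 + (1 - y) * ρb) / (1 - (y ^ 2 + (1 - y) * ρb))) + t2 * usage y T j (l + r + k) h) ≤ y ^ 2 + (1 - y) * ρ₀ := by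
    have main := GluedWindow.p2l y ρ₀ ((h : ℝ) - l) (T - T₀) r ((r : ℝ) + k) t0 t1 t2 hy0 hy1 hρ₀y.le ht0p ht1p ht2p hts
      (Nat.cast_nonneg r) (by linarith [show (0:ℝ) ≤ k from Nat.cast_nonneg k]) (by linarith [hK0, show (1:ℝ) ≤ r by exact_mod_cast hr])
      hdK (by linarith) hΔm
    have hz0 : 0 < 1 + y - ρ₀ := by linarith
    have eT₀ : T₀ = 2 * (l : ℝ) + ρ₀ * ((h : ℝ) - l) := by rw [hρ₀]; field_simp; ring
    have ea : (1 + y - ρ₀) * ((h : ℝ) - l) - (T - T₀) = ((h : ℝ) - l) * (1 + y - ρa) := by rw [eT₀, hρa]; field_simp; ring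
    have eb : (1 + y - ρ₀) * ((h : ℝ) - l) - (T - T₀) + (1 - y) * r = (((h : ℝ) - l) - r) * (1 + y - ρb) := by
      have hne : (h : ℝ) - ((l + r : ℕ) : ℝ) ≠ 0 := by rw [hL1r]; linarith [show (0:ℝ) ≤ k from Nat.cast_nonneg k]
      rw [eT₀, hρb]; field_simp; rw [hL1r]; ring
    have ec : (1 + y - ρ₀) * ((h : ℝ) - l) - (T - T₀) + (1 - y) * ((r : ℝ) + k) = (((h : ℝ) - l) - ((r : ℝ) + k)) * (1 + y - ρc) := by
      have hne : (h : ℝ) - ((l + r + k : ℕ) : ℝ) ≠ 0 := by rw [hL2r]; linarith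
      rw [eT₀, hρc]; field_simp; rw [hL2r]; ring
    rw [ec, eb, ea] at main
    have hza : 0 < 1 + y - ρa := by linarith [hρa1y]
    have hzb : 0 < 1 + y - ρb := hzbTop; have hzc : 0 < 1 + y - ρc := by linarith
    have hdb : (0:ℝ) < ((h : ℝ) - l) - r := by linarith [show (0:ℝ) ≤ k from Nat.cast_nonneg k]
    have hdc : (0:ℝ) < ((h : ℝ) - l) - ((r : ℝ) + k) := by linarith
    have qa : ((h : ℝ) - l) / (((h : ℝ) - l) * (1 + y - ρa)) = 1 / (1 + y - ρa) := by field_simp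
    have qb : (((h : ℝ) - l) - r) / ((((h : ℝ) - l) - r) * (1 + y - ρb)) = 1 / (1 + y - ρb) := by field_simp
    have qc : (((h : ℝ) - l) - ((r : ℝ) + k)) / ((((h : ℝ) - l) - ((r : ℝ) + k)) * (1 + y - ρc)) = 1 / (1 + y - ρc) := by field_simp
    rw [qa, qb, qc] at main
    rw [eκc]
    have fa : (y ^ 2 + (1 - y) * ρa) / (1 - (y ^ 2 + (1 - y) * ρa)) = 1 / ((1 - y) * (1 + y - ρa)) - 1 := by
      have e1 : 1 - (y ^ 2 + (1 - y) * ρa) = (1 - y) * (1 + y - ρa) := by ring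
      have hne : (1 - y) * (1 + y - ρa) ≠ 0 := (mul_pos h1y hza).ne'; rw [e1, eq_sub_iff_add_eq, div_add_one hne]
      congr 1; ring
    have fb : (y ^ 2 + (1 - y) * ρb) / (1 - (y ^ 2 + (1 - y) * ρb)) = 1 / ((1 - y) * (1 + y - ρb)) - 1 := by
      have e1 : 1 - (y ^ 2 + (1 - y) * ρb) = (1 - y) * (1 + y - ρb) := by ring
      have hne : (1 - y) * (1 + y - ρb) ≠ 0 := (mul_pos h1y hzb).ne'; rw [e1, eq_sub_iff_add_eq, div_add_one hne]
      congr 1; ring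
    have fc : (y ^ 2 + (1 - y) * ρc) / (1 - (y ^ 2 + (1 - y) * ρc)) = 1 / ((1 - y) * (1 + y - ρc)) - 1 := by
      have e1 : 1 - (y ^ 2 + (1 - y) * ρc) = (1 - y) * (1 + y - ρc) := by ring
      have hne : (1 - y) * (1 + y - ρc) ≠ 0 := by positivity
      rw [e1, eq_sub_iff_add_eq, div_add_one hne]
      congr 1; ring
    rw [fa, fb, fc]
    have key : (1 + y - ρ₀) * (t0 * (1 / (1 + y - ρa)) + t1 * (1 / (1 + y - ρb)) + t2 * (1 / (1 + y - ρc))) ≤ 1 := by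
      have := mul_le_mul_of_nonneg_left main hz0.le
      rwa [mul_one_div_cancel hz0.ne'] at this
    have eG : 1 - (y ^ 2 + (1 - y) * ρ₀) = (1 - y) * (1 + y - ρ₀) := by ring
    have expand : (1 - y) * (1 + y - ρ₀) * (t0 * (1 / ((1 - y) * (1 + y - ρa)) - 1) + t1 * (1 / ((1 - y) * (1 + y - ρb)) - 1) + t2 * (1 / ((1 - y) * (1 + y - ρc)) - 1))
        = (1 + y - ρ₀) * (t0 * (1 / (1 + y - ρa)) + t1 * (1 / (1 + y - ρb)) + t2 * (1 / (1 + y - ρc))) - (1 - y) * (1 + y - ρ₀) * (t0 + t1 + t2) := by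
      field_simp
      ring
    rw [eG, expand, hts]
    linarith
  have hγ0 : 0 ≤ y ^ 2 + (1 - y) * ρ₀ := by
    have : 0 ≤ ρ₀ := by rw [hρ₀]; exact div_nonneg (by linarith) hd0.le
    positivity
  have hzst : 0 < 1 + y - ρ₀ := by linarith
  have eγ1 : 1 - (y ^ 2 + (1 - y) * ρ₀) = (1 - y) * (1 + y - ρ₀) := by ring
  have hγ1 : 0 ≤ 1 - (y ^ 2 + (1 - y) * ρ₀) := by rw [eγ1]; positivity
  have hpA0 : 0 ≤ pA := by rw [hpA]; split_ifs; exacts [le_min (hp _) (hp _), hp _]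
  have hQnn : 0 ≤ min pA P := le_min hpA0 hP0; have hyt2 : y ≤ t2 := by rw [ht2]; linarith
  obtain ⟨As, hAs⟩ : ∃ As : ℝ, As = if h + r ≤ j then t0 + t1 else t0 := ⟨_, rfl⟩; have hPs : y ≤ 1 - As := by rw [hAs]; split_ifs <;> linarith
  have hRHS : As * pA + (1 - As) * P ≤ t0 * p h + t1 * p (h + r) + t2 * p (h + r + k) := by
    rw [hAs]; split_ifs with hmid
    · have h1 : pA ≤ p (h + r) := by rw [hpA, if_pos hmid]; exact min_le_right _ _
      have e1 := mul_le_mul_of_nonneg_left hpAh ht0p; have e2 := mul_le_mul_of_nonneg_left h1 ht1p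
      have e3 := mul_le_mul_of_nonneg_left hPH2 ht2p; have e4 : (1 - (t0 + t1)) * P = t2 * P := by rw [show 1 - (t0 + t1) = t2 by linarith]
      rw [e4]; linarith
    · have h1 : P ≤ p (h + r) := by
        have : q1 = p (h + r) := by rw [hq1d, if_neg hmid]
        rw [← this]; exact hPq1
      have e1 := mul_le_mul_of_nonneg_left hpAh ht0p; have e2 := mul_le_mul_of_nonneg_left h1 ht1p
      have e3 := mul_le_mul_of_nonneg_left hPH2 ht2p; have e4 : (1 - t0) * P = t1 * P + t2 * P := by rw [show 1 - t0 = t1 + t2 by linarith]; ring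
      rw [e4]; linarith
  have hza : 0 < 1 + y - ρa := by linarith [hρa1y]
  have huF : y / (1 - y) ≤ (y ^ 2 + (1 - y) * ρa) / (1 - (y ^ 2 + (1 - y) * ρa)) := by
    have e1 : 1 - (y ^ 2 + (1 - y) * ρa) = (1 - y) * (1 + y - ρa) := by ring
    rw [e1, div_le_div_iff₀ h1y (mul_pos h1y hza)]
    have e2 : y * ((1 - y) * (1 + y - ρa)) - (y ^ 2 + (1 - y) * ρa) * (1 - y) = (1 - y) * (y - ρa) := by ring
    have e3 := mul_nonneg h1y.le (sub_nonneg.2 hρay.le)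
    linarith only [e2, e3]
  have hzb' : 0 < 1 + y - ρb := hzbTop
  have huFb : y / (1 - y) ≤ (y ^ 2 + (1 - y) * ρb) / (1 - (y ^ 2 + (1 - y) * ρb)) := by
    have e1 : 1 - (y ^ 2 + (1 - y) * ρb) = (1 - y) * (1 + y - ρb) := by ring
    rw [e1, div_le_div_iff₀ h1y (mul_pos h1y hzb')]
    have e2 : y * ((1 - y) * (1 + y - ρb)) - (y ^ 2 + (1 - y) * ρb) * (1 - y) = (1 - y) * (y - ρb) := by ring
    have e3 := mul_nonneg h1y.le (show (0:ℝ) ≤ ρb - y by linarith only [hρby, hy1])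
    linarith only [e2, e3]
  have hP2c : (1 - (y ^ 2 + (1 - y) * ρ₀)) * (t0 * (y / (1 - y)) + t1 * (y / (1 - y)) + t2 * usage y T j (l + r + k) h) ≤ y ^ 2 + (1 - y) * ρ₀ := by
    have h0 := mul_le_mul_of_nonneg_left (mul_le_mul_of_nonneg_left huF ht0p) hγ1; have h1 := mul_le_mul_of_nonneg_left (mul_le_mul_of_nonneg_left huFb ht1p) hγ1
    linarith
  have poolα : ∀ L : ℕ, L ≤ j ∧ 2 * (L : ℝ) < T → α L ≤ y / (1 - y) * P := by
    intro L hL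
    have giantα : ∀ G : ℕ, j + 1 ≤ G → G ≤ B + (r + k) → α L ≤ y / (1 - y) * p G := by
      intro G hGj hGM
      have := hαp L G hL.1 hL.2 hGM (Or.inl hGj)
      rwa [usage_giant_eq y T j L G hGj] at this
    have b1 := giantα (h + r + k) (by omega) (by omega); have b2 := giantα (c + r + k) (by omega) (by omega)
    have b3 : α L ≤ y / (1 - y) * q1 := by
      rw [hq1d]; split_ifs with hh
      · exact b1
      · exact giantα (h + r) (by omega) (by omega)
    have b4 : α L ≤ y / (1 - y) * q2 := by
      rw [hq2d]; split_ifs with hh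
      · exact b2
      · exact giantα (c + r) (by omega) (by omega)
    rw [hP]
    rcases min_choice (min (p (h + r + k)) (p (c + r + k))) (min q1 q2) with e | e <;> rw [e]
    · rcases min_choice (p (h + r + k)) (p (c + r + k)) with e' | e' <;> rw [e'] <;> assumption
    · rcases min_choice q1 q2 with e' | e' <;> rw [e'] <;> assumption
  have hαlP := poolα l hL0; have hαl1P := poolα (l + r) hL1; rw [eΨl, eΨh, hγ]
  have hTlh : (l : ℝ) + r + h ≤ T := hinc1; have eT₀ : T₀ = 2 * (l : ℝ) + ρ₀ * ((h : ℝ) - l) := by rw [hρ₀]; field_simp; ring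
  have hmt0 : t1 * (r : ℝ) + t2 * ((r : ℝ) + k) ≤ (1 - t0) * ((r : ℝ) + k) := by
    have : t1 * (r : ℝ) ≤ t1 * ((r : ℝ) + k) := mul_le_mul_of_nonneg_left (by linarith) ht1p
    nlinarith only [this, hts]
  have hΔ' : T - T₀ ≤ (1 - t0) * ((r : ℝ) + k) := le_trans hΔm hmt0; have h1t0 : 0 < 1 - t0 := by rw [ht0]; linarith only [hq0]
  have ht0ρ : t0 + t1 ≤ ρ₀ := by
    have a1 : (1 - ρ₀) * ((h : ℝ) - l) ≤ T - T₀ - r := by linarith only [hTlh, eT₀]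
    have a2 : T - T₀ - r ≤ t2 * k := by have := hΔm; nlinarith only [this, hts, ht0p, hr0]
    have a3 : t2 * (k : ℝ) < t2 * ((h : ℝ) - l) := mul_lt_mul_of_pos_left (by linarith only [hdK, hr0]) (lt_of_lt_of_le hy0 hyt2)
    have a4 : (1 - ρ₀) * ((h : ℝ) - l) < t2 * ((h : ℝ) - l) := by linarith only [a1, a2, a3]
    have := lt_of_mul_lt_mul_right a4 hd0.le
    linarith only [this, hts]
  have Inc := GluedWindow.inc_row_ineq y (t0 + t1) ρ₀ (1 - As) hy0 hy1 (by linarith only [ht0p, ht1p]) ht0ρ hρ₀y.le hPs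
  have Wu : (1 - (y ^ 2 + (1 - y) * ρ₀)) * (y / (1 - y)) = y * (1 + y - ρ₀) := by rw [eγ1]; field_simp
  have hInc : (1 - (y ^ 2 + (1 - y) * ρ₀)) * (t0 + t1) * (y / (1 - y)) ≤ (y ^ 2 + (1 - y) * ρ₀) * (1 - As) := by
    have e : (1 - (y ^ 2 + (1 - y) * ρ₀)) * (t0 + t1) * (y / (1 - y)) = (t0 + t1) * (y * (1 + y - ρ₀)) := by rw [← Wu]; ring
    rw [e]; linarith only [Inc]
  have hAs0 : 0 ≤ As := by rw [hAs]; split_ifs <;> linarith only [ht0p, ht1p]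
  have hQP : min pA P ≤ P := min_le_right _ _; have hQA : min pA P ≤ pA := min_le_left _ _
  have f0 := mul_le_mul_of_nonneg_left hαlP (mul_nonneg hγ1 ht0p); have f1 := mul_le_mul_of_nonneg_left hαl1P (mul_nonneg hγ1 ht1p)
  have f2 := mul_le_mul_of_nonneg_left bC (mul_nonneg hγ1 ht2p)
  have g1 : (1 - (y ^ 2 + (1 - y) * ρ₀)) * (t2 * usage y T j (l + r + k) h) * min pA P ≤ ((y ^ 2 + (1 - y) * ρ₀) - (1 - (y ^ 2 + (1 - y) * ρ₀)) * (t0 + t1) * (y / (1 - y))) * min pA P := by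
    refine mul_le_mul_of_nonneg_right ?_ hQnn
    linarith only [hP2c]
  have g2 : (1 - (y ^ 2 + (1 - y) * ρ₀)) * (t0 + t1) * (y / (1 - y)) * (P - min pA P) ≤ (y ^ 2 + (1 - y) * ρ₀) * (1 - As) * (P - min pA P) := mul_le_mul_of_nonneg_right hInc (by linarith only [hQP])
  have g3 : (y ^ 2 + (1 - y) * ρ₀) * As * min pA P ≤ (y ^ 2 + (1 - y) * ρ₀) * As * pA := mul_le_mul_of_nonneg_left hQA (mul_nonneg hγ0 hAs0); have fR := mul_le_mul_of_nonneg_left hRHS hγ0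
  nlinarith only [f0, f1, f2, g1, g2, g3, fR]
end LawDec
end Quant
end Summit.CriticalPhenomena.PercolationContinuityZ3.Theorems
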